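import Summits.Ventures.PercRepro.C025ProfileThinAll
import Summits.Ventures.PercRepro.C025ProfileThinGirthSeven
import Summits.Ventures.PercRepro.C025ProfileThinGirthEight

/-!
# THE THIN REGIME OF SIMPLE MATROIDS IS CLOSED FOR `q ≤ 63` (night-3 g15)
`C025ProfileThinAll` with the cascades `g = 7` (`profileIneq_thinSeven`, `q ≥ 14`) and `g = 8` (`profileIneq_thinEight`, `q ≥ 18`) added
to the girth case split: a dependent set of `≤ 8` points of minimum cardinality is a `g₀`-circuit, `3 ≤ g₀ ≤ 8`; for `g₀ ≥ 7` below the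
cascade threshold T(q, g₀, n) applies (`q ≤ g₀ (g₀ − 2)`: `35`, `48`); for girth `≥ 9` T(q, 9, n) applies when `q ≤ 63`.
**THEOREM** `profileIneq_thin_simple_le_63` / `hallIneq_thin_simple_le_63`: every finite simple matroid in which every rank-`q` set has at
most `q + 1` points, `q ≤ 63`, satisfies the row `(q, q+1)` of C-032 and its Hall form (C-033) for every `n`. The next cascade (`g = 9`,
`q ≥ 22` by the sweep of `lab/gsym.py`) would move the bound to `q ≤ 80`.
-/
open scoped Matroid
namespace PercRepro
open Set Finset ThmH Staged
namespace ThinGirth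
variable {α : Type} [DecidableEq α] {M : Matroid α} [M.Finite]

/-- **THE THIN REGIME OF SIMPLE MATROIDS, `q ≤ 63`**: every finite simple matroid in which every rank-`q` set has at most `q + 1`
points satisfies the row `(q, q+1)` of (Π) and its Hall form, for every `n`. -/
theorem profileIneq_thin_simple_le_63 (q : ℕ) (hq : q ≤ 63)
    (hsimple : ∀ T ⊆ M.E, T.encard ≤ 2 → M.Indep T)
    (hthin : ∀ X ⊆ gr M, rkN M X = q → X.card ≤ q + 1) :
    Profile.ProfileIneq M q (q + 1) ∧ Profile.HallIneq M q (q + 1) := by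
  rcases Nat.lt_or_ge ((gr M).card - q - 1) q with hlt | hge
  · exact ThinTriangle.profileIneq_of_small q hlt
  have hsimple' : ∀ X ⊆ gr M, X.card ≤ 2 → rkN M X = X.card := by
    intro X hXg hXc
    have hXE : (X : Set α) ⊆ M.E := by rw [← coe_gr]; exact_mod_cast hXg
    apply OneCircuit.rkN_eq_card_of_indep
    apply hsimple _ hXE
    rw [Set.encard_coe_eq_coe_finsetCard]
    exact_mod_cast hXc
  -- the size condition of the simple rule T(q, g, n) at `f ≥ q` and `q ≤ g (g − 2)`
  have hsize : ∀ g : ℕ, 3 ≤ g → q ≤ g * (g - 2) → g * (q + 2 - g) ≤ (g - 1) * ((gr M).card - q - 1) := by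
    intro g hg3 hqg
    calc g * (q + 2 - g) ≤ (g - 1) * q := by
          rcases Nat.lt_or_ge (q + 2) g with h | h
          · rw [Nat.sub_eq_zero_of_le h.le]; simp
          · obtain ⟨g', rfl⟩ : ∃ g', g = g' + 3 := ⟨g - 3, by omega⟩
            have e1 : q + 2 - (g' + 3) = q - (g' + 1) := by omega
            have e2 : g' + 3 - 1 = g' + 2 := by omega
            have e3 : g' + 3 - 2 = g' + 1 := by omega
            rw [e1, e2]
            rw [e3] at hqg
            have hq1 : g' + 1 ≤ q := by omega
            zify [hq1]
            nlinarith
      _ ≤ (g - 1) * ((gr M).card - q - 1) := Nat.mul_le_mul_left _ hge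
  by_cases hP : ∀ X ⊆ gr M, X.card ≤ 8 → rkN M X = X.card
  · -- girth `≥ 9`: the simple rule with `g = 9`
    have hg9 : ∀ T ⊆ M.E, T.encard < (9 : ℕ) → M.Indep T :=
      indep_of_forall_rkN (g := 9) (fun X hXg hXc => hP X hXg (by omega))
    have hs := hsize 9 (by norm_num) (by omega)
    exact ⟨ThinRow.profileIneq_succ_of_thin_size q 9 (by norm_num) hs hg9 hthin,
      ThinRow.hallIneq_succ_of_thin_size q 9 (by norm_num) hs hg9 hthin⟩
  · -- a dependent set of `≤ 8` points of minimum cardinality is a `g₀`-circuit, `3 ≤ g₀ ≤ 8`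
    push Not at hP
    obtain ⟨X₀, hX₀g, hX₀c, hX₀r⟩ := hP
    set S := (gr M).powerset.filter (fun X => X.card ≤ 8 ∧ rkN M X ≠ X.card) with hS
    have hX₀S : X₀ ∈ S := by
      rw [hS, Finset.mem_filter, Finset.mem_powerset]
      exact ⟨hX₀g, hX₀c, hX₀r⟩
    obtain ⟨C, hCS, hCmin⟩ := Finset.exists_min_image S Finset.card ⟨X₀, hX₀S⟩
    rw [hS, Finset.mem_filter, Finset.mem_powerset] at hCS
    obtain ⟨hCg, hCc6, hCr⟩ := hCS
    -- every smaller subset of the ground set has full rank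
    have hgirth : ∀ X ⊆ gr M, X.card + 1 ≤ C.card → rkN M X = X.card := by
      intro X hXg hXc
      by_contra hne
      have hXS : X ∈ S := by
        rw [hS, Finset.mem_filter, Finset.mem_powerset]
        exact ⟨hXg, by omega, hne⟩
      have := hCmin X hXS
      omega
    have hCrk : rkN M C + 1 = C.card := by
      have h1 : rkN M C ≤ C.card := rkN_le_card C
      have h2 : rkN M C ≠ C.card := hCr
      -- `C ∖ {c}` has full rank `|C| − 1`
      have hCpos : 0 < C.card := by
        by_contra h0
        push Not at h0
        have := rkN_le_card (M := M) C
        omega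
      obtain ⟨c, hc⟩ : C.Nonempty := Finset.card_pos.mp hCpos
      have hce := Finset.card_erase_of_mem hc
      have h3 := hgirth (C.erase c) ((Finset.erase_subset c C).trans hCg) (by omega)
      have h4 : rkN M (C.erase c) ≤ rkN M C := rkN_mono (Finset.erase_subset c C)
      omega
    have hC3 : 3 ≤ C.card := by
      by_contra h
      push Not at h
      exact hCr (hsimple' C hCg (by omega))
    -- the six girths
    rcases (by omega : C.card = 3 ∨ C.card = 4 ∨ C.card = 5 ∨ C.card = 6 ∨ C.card = 7 ∨ C.card = 8) with
      h3 | h4 | h5 | h6 | h7 | h8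
    · rcases Nat.lt_or_ge q 4 with hq4 | hq4
      · have hs := hsize 3 (by norm_num) (by omega)
        have hg := indep_of_forall_rkN (g := 3) (fun X hXg hXc => hgirth X hXg (by omega))
        exact ⟨ThinRow.profileIneq_succ_of_thin_size q 3 (by norm_num) hs hg hthin,
          ThinRow.hallIneq_succ_of_thin_size q 3 (by norm_num) hs hg hthin⟩
      · exact ThinTriangle.profileIneq_thinTriangle q hq4 hsimple' hthin C hCg h3 (by omega)
    · rcases Nat.lt_or_ge q 6 with hq6 | hq6
      · have hs := hsize 4 (by norm_num) (by omega)
        have hg := indep_of_forall_rkN (g := 4) (fun X hXg hXc => hgirth X hXg (by omega))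
        exact ⟨ThinRow.profileIneq_succ_of_thin_size q 4 (by norm_num) hs hg hthin,
          ThinRow.hallIneq_succ_of_thin_size q 4 (by norm_num) hs hg hthin⟩
      · exact profileIneq_thinFour q hq6 (fun X hXg hXc => hgirth X hXg (by omega)) hthin C hCg h4 (by omega)
    · rcases Nat.lt_or_ge q 9 with hq9 | hq9
      · have hs := hsize 5 (by norm_num) (by omega)
        have hg := indep_of_forall_rkN (g := 5) (fun X hXg hXc => hgirth X hXg (by omega))
        exact ⟨ThinRow.profileIneq_succ_of_thin_size q 5 (by norm_num) hs hg hthin,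
          ThinRow.hallIneq_succ_of_thin_size q 5 (by norm_num) hs hg hthin⟩
      · exact profileIneq_thinFive q hq9 (fun X hXg hXc => hgirth X hXg (by omega)) hthin C hCg h5 (by omega)
    · rcases Nat.lt_or_ge q 12 with hq12 | hq12
      · have hs := hsize 6 (by norm_num) (by omega)
        have hg := indep_of_forall_rkN (g := 6) (fun X hXg hXc => hgirth X hXg (by omega))
        exact ⟨ThinRow.profileIneq_succ_of_thin_size q 6 (by norm_num) hs hg hthin,
          ThinRow.hallIneq_succ_of_thin_size q 6 (by norm_num) hs hg hthin⟩
      · exact profileIneq_thinSix q hq12 (fun X hXg hXc => hgirth X hXg (by omega)) hthin C hCg h6 (by omega)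
    · rcases Nat.lt_or_ge q 14 with hq14 | hq14
      · have hs := hsize 7 (by norm_num) (by omega)
        have hg := indep_of_forall_rkN (g := 7) (fun X hXg hXc => hgirth X hXg (by omega))
        exact ⟨ThinRow.profileIneq_succ_of_thin_size q 7 (by norm_num) hs hg hthin,
          ThinRow.hallIneq_succ_of_thin_size q 7 (by norm_num) hs hg hthin⟩
      · exact profileIneq_thinSeven q hq14 (fun X hXg hXc => hgirth X hXg (by omega)) hthin C hCg h7 (by omega)
    · rcases Nat.lt_or_ge q 18 with hq18 | hq18
      · have hs := hsize 8 (by norm_num) (by omega)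
        have hg := indep_of_forall_rkN (g := 8) (fun X hXg hXc => hgirth X hXg (by omega))
        exact ⟨ThinRow.profileIneq_succ_of_thin_size q 8 (by norm_num) hs hg hthin,
          ThinRow.hallIneq_succ_of_thin_size q 8 (by norm_num) hs hg hthin⟩
      · exact profileIneq_thinEight q hq18 (fun X hXg hXc => hgirth X hXg (by omega)) hthin C hCg h8 (by omega)

/-- The thin regime of simple matroids, `q ≤ 63`: the row alone. -/
theorem profileIneq_thin_simple_le_63' (q : ℕ) (hq : q ≤ 63)
    (hsimple : ∀ T ⊆ M.E, T.encard ≤ 2 → M.Indep T)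
    (hthin : ∀ X ⊆ gr M, rkN M X = q → X.card ≤ q + 1) :
    Profile.ProfileIneq M q (q + 1) :=
  (profileIneq_thin_simple_le_63 q hq hsimple hthin).1

/-- The thin regime of simple matroids, `q ≤ 63`: the Hall form (C-033). -/
theorem hallIneq_thin_simple_le_63 (q : ℕ) (hq : q ≤ 63)
    (hsimple : ∀ T ⊆ M.E, T.encard ≤ 2 → M.Indep T)
    (hthin : ∀ X ⊆ gr M, rkN M X = q → X.card ≤ q + 1) :
    Profile.HallIneq M q (q + 1) :=
  (profileIneq_thin_simple_le_63 q hq hsimple hthin).2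

/-- The row `(40, 41)` on every thin(40) simple matroid — every `n`, every girth. -/
theorem profileIneq_forty_thin_simple (hsimple : ∀ T ⊆ M.E, T.encard ≤ 2 → M.Indep T)
    (hthin : ∀ X ⊆ gr M, rkN M X = 40 → X.card ≤ 41) : Profile.ProfileIneq M 40 41 :=
  profileIneq_thin_simple_le_63' 40 (by norm_num) hsimple hthin

end ThinGirth
end PercRepro
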